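import Mathlib
import Summits.BirchSwinnertonDyer.BirchSwinnertonDyer.Theorems.ResidualThetaTransportAtTwoSignedMuSeedAtTwoPlusNonsquareDescentHerbrandIndex
import Summits.BirchSwinnertonDyer.BirchSwinnertonDyer.Theorems.ResidualThetaTransportAtTwoSignedMuSeedAtTwoPlusNonsquareDescentUniversalNorms
import HarnessLib

/-!
# Non-square descent — UNITS MODULO UNIVERSAL NORMS: `[E_n : 𝒩_n] ≤ sup_m #H¹(G_{m,n}, E_m)`, the composed E-side of stub S2's residue
# «`[𝓔_n^χ : 𝒩_n] ≤ #F^χ`» (line `nonsquare-descent`) — seed crux `SignedMuSeedAtTwoPlus` stmt-BirchSwinnertonDyer-21438 (parent Kμ⁺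
# `SignedMuVanishingAtTwoPlus` stmt-BirchSwinnertonDyer-20689, route ResidualThetaTransportAtTwo), line card `Cruxes/SignedMuSeedAtTwoPlus/Lines/nonsquare-descent.md`

Cell `bsd-wall`, width seat `bsd-wall-rtt-p4-w2` g19 (`--supports`, closes nothing).  THEOREMS ONLY; BSD is not proved by this and nothing
arithmetic is asserted: module algebra over a commutative ring.

This file COMPOSES `…HerbrandIndex` (finite level: `[E_n : N_{m,n}E_m] = #H¹(G_{m,n}, E_m)`, finite) with `…UniversalNorms` (stabilisation +
adic König) into the factor `#(E_n ⧸ range π_n)` of g18's `…NormIndexSplit` («units modulo UNIVERSAL norms»).  Tower currency (base level `n`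
re-indexed as `0`, level `n+j` as `j`): `E j` an `R`-module (`𝓔_{n+j}^χ ⊗ ℤ₂`, a `Λ'`-module killed by `ν_j ω`, `ω = ω_n`, `ν_j = ν_{n+j,n}`),
`N j : E (j+1) → E j` the norms, `Nc j i : E j → E i` their composites (data, with `Nc j j = id`, `Nc (j+1) i = Nc j i ∘ N j`), `ι j : E 0 ↪ E j`
the inclusions (Galois descent: injective with range `E j[ω]`) with **`ι j ∘ Nc j 0 = ν_j •`** (norm then include = multiply by the norm
element), the limit `π i : E_∞ → E i` (compatible, and COMPLETE: every norm-coherent sequence comes from `E_∞` — e.g. `E_∞` = the coherent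
sequences).  Then:

* §1 `comp_Nc_eq` (`N i ∘ Nc j (i+1) = Nc j i`, from the two composition laws), `Nc_apply_chain` / **`mem_range_Nc_iff_exists_chain`**
  (`range (Nc j 0)` = ends of norm-chains of length `j`), `range_Nc_antitone`.
* §2 **`range_proj_eq_iInf_range_Nc`** — `range π_0 = ⋂_j range (Nc j 0)` for adically complete levels with finite truncations
  (`…UniversalNorms.exists_coherent_of_forall_exists_chain`).
* §3 `range_Nc_eq_comap_smul_top` (`range (Nc j 0) = ι_j⁻¹(ν_j E_j)`), **`natCard_quotient_range_Nc_eq`** (`#(E_0 ⧸ range (Nc j 0)) =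
  (E_j[ν_j] : ωE_j) = #H¹`, finite — `…HerbrandIndex` on the Freeness data of level `j`).
* §4 **`natCard_quotient_range_proj_le`** — THE COMPOSED BOUND: if `(E_j[ν_j] : ωE_j) ≤ K` for all `j` (the Hilbert-90/capitulation side:
  `…HilbertNinety`, `…CapitulationSplit`, `…CapitulationKernel`), then **`#(E_0 ⧸ range π_0) ≤ K`**, finite — «`[𝓔_n^χ : 𝒩_n] ≤ #F^χ`» in the
  exact shape `Nat.card (En ⧸ LinearMap.range π)` consumed by `…NormIndexSplit.natCard_quotient_span_proj_dvd'`.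

[folklore]
-/

set_option autoImplicit false
-- the Theorems namespace of this sub repeats the summit name by design (D-0017 nested layout)
set_option linter.dupNamespace false

open scoped Pointwise nonZeroDivisors
open Literature.Algebra.Homology

namespace Summit.BirchSwinnertonDyer.BirchSwinnertonDyer.Theorems.SignedMuAtTwo.NonsquareDescent

universe u v w

variable {R : Type u} [CommRing R] (E : ℕ → Type v) [∀ i, AddCommGroup (E i)] [∀ i, Module R (E i)]
  (N : ∀ i, E (i + 1) →ₗ[R] E i) (Nc : ∀ j i, E j →ₗ[R] E i)

/-! ## §1 Composite norms and norm-chains -/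

section Chains

/-- The bottom composition law `N i ∘ Nc j (i+1) = Nc j i` (`i < j`) from `Nc j j = id` and the top law `Nc (j+1) i = Nc j i ∘ N j`. [folklore] -/
theorem comp_Nc_eq (hNc0 : ∀ j, Nc j j = LinearMap.id) (hNcS : ∀ j i, i ≤ j → Nc (j + 1) i = Nc j i ∘ₗ N j) :
    ∀ j i, i < j → N i ∘ₗ Nc j (i + 1) = Nc j i := by
  intro j
  induction j with
  | zero => intro i hi; exact absurd hi (Nat.not_lt_zero i)
  | succ j ih =>
    intro i hi
    rcases Nat.lt_succ_iff_lt_or_eq.1 hi with h | h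
    · rw [hNcS j (i + 1) h, hNcS j i (le_of_lt h), ← LinearMap.comp_assoc, ih i h]
    · subst h
      rw [hNc0, hNcS i i le_rfl, hNc0, LinearMap.comp_id, LinearMap.id_comp]

/-- Along a norm-chain of length `j`, `Nc j i (y j) = y i` for `i ≤ j`. [folklore] -/
theorem Nc_apply_chain (hNc0 : ∀ j, Nc j j = LinearMap.id) (hNcS : ∀ j i, i ≤ j → Nc (j + 1) i = Nc j i ∘ₗ N j) :
    ∀ (j : ℕ) (y : ∀ i, E i), (∀ i, i < j → N i (y (i + 1)) = y i) → ∀ i, i ≤ j → Nc j i (y j) = y i := by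
  intro j
  induction j with
  | zero =>
    intro y _ i hi
    obtain rfl := Nat.le_zero.1 hi
    rw [hNc0, LinearMap.id_apply]
  | succ j ih =>
    intro y hy i hi
    rcases Nat.lt_succ_iff_lt_or_eq.1 (Nat.lt_succ_of_le hi) with h | h
    · have h' : i ≤ j := Nat.lt_succ_iff.1 h
      rw [hNcS j i h', LinearMap.comp_apply, hy j (Nat.lt_succ_self j)]
      exact ih y (fun k hk => hy k (Nat.lt_succ_of_lt hk)) i h'
    · subst h
      rw [hNc0, LinearMap.id_apply]

/-- **`range (Nc j 0)` = the ends of norm-chains of length `j`.** [folklore] -/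
theorem mem_range_Nc_iff_exists_chain (hNc0 : ∀ j, Nc j j = LinearMap.id) (hNcS : ∀ j i, i ≤ j → Nc (j + 1) i = Nc j i ∘ₗ N j)
    (j : ℕ) (x₀ : E 0) :
    x₀ ∈ LinearMap.range (Nc j 0) ↔ ∃ y : ∀ i, E i, y 0 = x₀ ∧ ∀ i, i < j → N i (y (i + 1)) = y i := by
  constructor
  · rintro ⟨x, rfl⟩
    refine ⟨fun i => Nc j i x, rfl, fun i hi => ?_⟩
    rw [← LinearMap.comp_apply, comp_Nc_eq E N Nc hNc0 hNcS j i hi]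
  · rintro ⟨y, hy0, hy⟩
    exact ⟨y j, by rw [Nc_apply_chain E N Nc hNc0 hNcS j y hy 0 (Nat.zero_le j), hy0]⟩

/-- The ranges `range (Nc j 0)` decrease with `j`. [folklore] -/
theorem range_Nc_antitone (hNcS : ∀ j i, i ≤ j → Nc (j + 1) i = Nc j i ∘ₗ N j) :
    Antitone fun j => LinearMap.range (Nc j 0) := by
  refine antitone_nat_of_succ_le fun j => ?_
  show LinearMap.range (Nc (j + 1) 0) ≤ LinearMap.range (Nc j 0)
  rw [hNcS j 0 (Nat.zero_le j)]
  exact LinearMap.range_comp_le_range _ _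

end Chains

/-! ## §2 Universal norms: `range π_0 = ⋂_j range (Nc j 0)` -/

section Limit

variable {Einf : Type w} [AddCommGroup Einf] [Module R Einf] (π : ∀ i, Einf →ₗ[R] E i)

/-- `range π_0` = the `0`-th terms of norm-coherent sequences, for a compatible COMPLETE limit. [folklore] -/
theorem mem_range_proj_iff (hπ : ∀ i e, N i (π (i + 1) e) = π i e)
    (hlift : ∀ x : ∀ i, E i, (∀ i, N i (x (i + 1)) = x i) → ∃ e : Einf, ∀ i, π i e = x i) (x₀ : E 0) :
    x₀ ∈ LinearMap.range (π 0) ↔ ∃ x : ∀ i, E i, x 0 = x₀ ∧ ∀ i, N i (x (i + 1)) = x i := by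
  constructor
  · rintro ⟨e, rfl⟩
    exact ⟨fun i => π i e, rfl, fun i => hπ i e⟩
  · rintro ⟨x, hx0, hx⟩
    obtain ⟨e, he⟩ := hlift x hx
    exact ⟨e, by rw [he 0, hx0]⟩

/-- **`range π_0 = ⋂_j range (Nc j 0)`** — universal norms are the intersection of the finite-level norm groups, for `I`-adically complete
levels with finite truncations (`…UniversalNorms`). [folklore] -/
theorem range_proj_eq_iInf_range_Nc (I : Ideal R) [∀ i, IsAdicComplete I (E i)]
    (hfin : ∀ i k, Finite (E i ⧸ (I ^ k • ⊤ : Submodule R (E i))))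
    (hNc0 : ∀ j, Nc j j = LinearMap.id) (hNcS : ∀ j i, i ≤ j → Nc (j + 1) i = Nc j i ∘ₗ N j)
    (hπ : ∀ i e, N i (π (i + 1) e) = π i e)
    (hlift : ∀ x : ∀ i, E i, (∀ i, N i (x (i + 1)) = x i) → ∃ e : Einf, ∀ i, π i e = x i) :
    LinearMap.range (π 0) = ⨅ j, LinearMap.range (Nc j 0) := by
  ext x₀
  rw [Submodule.mem_iInf, mem_range_proj_iff E N π hπ hlift]
  have h := Set.ext_iff.1 (setOf_exists_coherent_eq_iInter I E N hfin) x₀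
  simp only [Set.mem_setOf_eq, Set.mem_iInter] at h
  rw [h]
  exact forall_congr' fun j => (mem_range_Nc_iff_exists_chain E N Nc hNc0 hNcS j x₀).symm

end Limit

/-! ## §3 Finite level: `#(E_0 ⧸ range (Nc j 0)) = (E_j[ν_j] : ωE_j) = #H¹`, finite -/

section Level

variable {E N Nc}

/-- **`range (Nc j 0) = ι_j⁻¹(ν_j E_j)`** when `ι_j` is injective and `ι_j ∘ Nc j 0 = ν_j •`. [folklore] -/
theorem range_Nc_eq_comap_smul_top {j : ℕ} {ν : R} (ι : E 0 →ₗ[R] E j) (hι : Function.Injective ι)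
    (hιN : ∀ x : E j, ι (Nc j 0 x) = ν • x) :
    LinearMap.range (Nc j 0) = (ν • (⊤ : Submodule R (E j))).comap ι := by
  ext y
  rw [LinearMap.mem_range, Submodule.mem_comap, Submodule.mem_smul_pointwise_iff_exists]
  constructor
  · rintro ⟨x, rfl⟩
    exact ⟨x, Submodule.mem_top, (hιN x).symm⟩
  · rintro ⟨x, -, hx⟩
    exact ⟨x, hι (by rw [hιN, hx])⟩

/-- **`#(E_0 ⧸ range (Nc j 0)) = (E_j[ν_j] : ωE_j)`** («`[𝓔_n^χ : N_{m,n}𝓔_m^χ] = #H¹(G_{m,n}, 𝓔_m^χ)`») on the Freeness data of level `j`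
(`E j` killed by `ν ω`, `u ∈ E j` with annihilator exactly `(ν ω)`, `E j ⧸ R∙u` finite; `ι` injective with range `E j[ω]`, `ι ∘ Nc j 0 = ν •`).
[folklore] -/
theorem natCard_quotient_range_Nc_eq {j : ℕ} {ν ω : R} (hω : ω ∈ R⁰) (hν : ν ∈ R⁰)
    (hE : ∀ x : E j, (ν * ω) • x = 0) {u : E j} (hu : ∀ r : R, r • u = 0 → ν * ω ∣ r)
    [Finite (E j ⧸ Submodule.span R {u})] (ι : E 0 →ₗ[R] E j) (hι : Function.Injective ι)
    (hιω : ∀ x : E 0, ω • ι x = 0) (hιr : ∀ e : E j, ω • e = 0 → e ∈ LinearMap.range ι)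
    (hιN : ∀ x : E j, ι (Nc j 0 x) = ν • x) :
    Nat.card (E 0 ⧸ LinearMap.range (Nc j 0)) =
      Herbrand.index (Submodule.torsionBy R (E j) ν) (ω • (⊤ : Submodule R (E j))) := by
  rw [range_Nc_eq_comap_smul_top ι hι hιN]
  exact natCard_quotient_comap_smul_top_eq hω hν hE hu ι hιω hιr

/-- … and `E_0 ⧸ range (Nc j 0)` is finite. [folklore] -/
theorem natCard_quotient_range_Nc_ne_zero {j : ℕ} {ν ω : R} (hω : ω ∈ R⁰)
    (hE : ∀ x : E j, (ν * ω) • x = 0) {u : E j} (hu : ∀ r : R, r • u = 0 → ν * ω ∣ r)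
    [Finite (E j ⧸ Submodule.span R {u})] (ι : E 0 →ₗ[R] E j) (hι : Function.Injective ι)
    (hιω : ∀ x : E 0, ω • ι x = 0) (hιr : ∀ e : E j, ω • e = 0 → e ∈ LinearMap.range ι)
    (hιN : ∀ x : E j, ι (Nc j 0 x) = ν • x) :
    Nat.card (E 0 ⧸ LinearMap.range (Nc j 0)) ≠ 0 := by
  rw [range_Nc_eq_comap_smul_top ι hι hιN]
  haveI := finite_quotient_comap_smul_top hω hE hu ι hιω hιr
  exact Nat.card_pos.ne'

end Level

/-! ## §4 The composed bound `#(E_0 ⧸ range π_0) ≤ K` -/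

section Composed

variable {Einf : Type w} [AddCommGroup Einf] [Module R Einf] (π : ∀ i, Einf →ₗ[R] E i)

/-- **UNITS MODULO UNIVERSAL NORMS: `#(E_0 ⧸ range π_0) ≤ K`, finite** — «`[𝓔_n^χ : 𝒩_n] ≤ sup_m #H¹(G_{m,n}, 𝓔_m^χ) ≤ #F^χ`».  Along the
norm tower (`N`, composites `Nc`, Galois-descent inclusions `ι j : E 0 ↪ E j` with range `E j[ω]` and `ι j ∘ Nc j 0 = ν j •`), with the
Freeness data of every level (`E j` killed by `ν j ω`; `u j` with annihilator exactly `(ν j ω)`; `E j ⧸ R∙u j` finite — stub S1), `I`-adically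
complete levels with finite truncations and a complete compatible limit `π`: if the `H¹`-indices `(E_j[ν_j] : ωE_j)` are `≤ K` for all `j`,
then `#(E_0 ⧸ range π_0) ≤ K` and `E_0 ⧸ range π_0` is finite — the factor `Nat.card (En ⧸ LinearMap.range π)` of `…NormIndexSplit`. [folklore] -/
theorem natCard_quotient_range_proj_le (I : Ideal R) [∀ i, IsAdicComplete I (E i)]
    (hfin : ∀ i k, Finite (E i ⧸ (I ^ k • ⊤ : Submodule R (E i))))
    (hNc0 : ∀ j, Nc j j = LinearMap.id) (hNcS : ∀ j i, i ≤ j → Nc (j + 1) i = Nc j i ∘ₗ N j)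
    (hπ : ∀ i e, N i (π (i + 1) e) = π i e)
    (hlift : ∀ x : ∀ i, E i, (∀ i, N i (x (i + 1)) = x i) → ∃ e : Einf, ∀ i, π i e = x i)
    {ω : R} (hω : ω ∈ R⁰) (ν : ℕ → R) (hν : ∀ j, ν j ∈ R⁰) (hE : ∀ j (x : E j), (ν j * ω) • x = 0)
    (u : ∀ j, E j) (hu : ∀ j (r : R), r • u j = 0 → ν j * ω ∣ r) (hfu : ∀ j, Finite (E j ⧸ Submodule.span R {u j}))
    (ι : ∀ j, E 0 →ₗ[R] E j) (hι : ∀ j, Function.Injective (ι j)) (hιω : ∀ j (x : E 0), ω • ι j x = 0)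
    (hιr : ∀ j (e : E j), ω • e = 0 → e ∈ LinearMap.range (ι j)) (hιN : ∀ j (x : E j), ι j (Nc j 0 x) = ν j • x)
    (K : ℕ) (hK : ∀ j, Herbrand.index (Submodule.torsionBy R (E j) (ν j)) (ω • (⊤ : Submodule R (E j))) ≤ K) :
    Nat.card (E 0 ⧸ LinearMap.range (π 0)) ≤ K ∧ Nat.card (E 0 ⧸ LinearMap.range (π 0)) ≠ 0 := by
  have hcard : ∀ j, Nat.card (E 0 ⧸ LinearMap.range (Nc j 0)) ≤ K := fun j => by
    haveI := hfu j
    rw [natCard_quotient_range_Nc_eq hω (hν j) (hE j) (hu j) (ι j) (hι j) (hιω j) (hιr j) (hιN j)]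
    exact hK j
  have hne : ∀ j, Nat.card (E 0 ⧸ LinearMap.range (Nc j 0)) ≠ 0 := fun j => by
    haveI := hfu j
    exact natCard_quotient_range_Nc_ne_zero hω (hE j) (hu j) (ι j) (hι j) (hιω j) (hιr j) (hιN j)
  rw [range_proj_eq_iInf_range_Nc E N Nc π I hfin hNc0 hNcS hπ hlift]
  exact natCard_quotient_iInf_le (fun j => LinearMap.range (Nc j 0)) (range_Nc_antitone E N Nc hNcS) K hcard hne

end Composed

end Summit.BirchSwinnertonDyer.BirchSwinnertonDyer.Theorems.SignedMuAtTwo.NonsquareDescent
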